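import Summits.Ventures.CertifiedManyBodySolver.Downfold.PhaseMapBranchRoads

/-!
# WHICH primary governs a column on a P-dependent route: the material-level `words[0]` or the `by_P[P]` row
# (FINDING F25) — two readings as total functions, where they differ, and why W9 and the item-7 fence must share ONE

Venture CertifiedManyBodySolver, cell `pub/hubbard-downfold`, seat hubbard-downfold-score-1 (second scoring engine);
namespace `Summit.Ventures.CertifiedManyBodySolver.Downfold.CellScore` (continues `PhaseMapRouterPrimaryCells` /
`PhaseMapBranchRoads`: `verdict`, `kind`, `cellsUnder`, `verdictFenced`). Context (2026-08-27): a phase map carries the router's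
words twice — `header.router.words[0]` (the word at the lowest routed P) and `header.router.by_P[]` (one row per pressure
column). On a route whose word changes with P the two name DIFFERENT primaries for some column (RUN #18/#19 of record: 96 of
182 maps carry `by_P`; 6 columns on 4 materials differ — M86 Zr @30 «EPH» under words[0] «UND:MIXED», M100 @21.5, M105
@22.2/@40, M40 @20/@40; every one of their 132 cells is `undetermined` today, so no scored number depends on the reading yet).
ACCEPTANCE v1.8's W9 («no «not» under an UND primary», §3.3 R-2W (c)) reads `words[0]` in both engines; the v1.9 DRAFT's item 7
(«a T_c band under an UND primary is fenced: W9b, band ignored», F23) and the pen's `undband_audit` read `by_P[P]`.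

WHAT THIS IS NOT: a ruling (Q-F25 is the acceptance pen's), a statement about zirconium, or the scorer of record. It is the
KERNEL FORM of the finding: the two readings as Boolean functions of a column's two flags, the exact condition under which they
differ, the F25 witness (a Zr-shaped two-column material is decided SC under one reading and ABSTAINS under the other, from the
same map), and the COHERENCE statement — with ONE reading a column whose band is read never draws W9 on its «not» cells, with
the MIXED pair (W9 by words[0], fence by by_P) the live Zr column does both at once.

* §1 `ColPrim` = the two flags the scorer can see per column (`hdrUND` = words[0] is an UND:* word; `rowUND` = the by_P row's
  primary is UND:*, `none` when no row lists that P); `govHeader`, `govByP` = the two readings; `govByP_eq_govHeader_iff_not_split`.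
* §2 the fence per column under a reading (`bandRead`), the two-column material verdict `verdict2`, and the F25 WITNESS
  `f25_witness_byP` / `f25_witness_header` / `f25_kinds`: cells all undetermined, a band [lo, hi] with lo ≥ 1/10 K on the column
  whose by_P row is decided ⇒ SC (TP/FP) by the per-P reading, UNDETERMINED (ABSTAIN) by the material-level one; and the converse
  shape. `verdict2_header_eq_verdictFenced`: the material-level reading IS `PhaseMapBranchRoads.verdictFenced` with one flag.
* §3 W9 as a predicate (`w9`) and COHERENCE: `coherent_of_one_reading` (any single reading: band read ⇒ no W9 on the column;
  W9 ⇒ band fenced) versus `mixed_readers_incoherent` (W9 := words[0], fence := by_P: the Zr column's band is READ and each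
  of its «not» cells draws W9). `blocked` (the F22 decidability premise per material) under the two readings: `blocked_split`.
* §4 the agreement case (every run of record so far): no by_P row, or rows agreeing with words[0] ⇒ the readings coincide
  column by column and so do fence, W9 and `blocked` (`all_coincide_of_no_split`).
* §5 (APPEND, same day) the RULING — ACCEPTANCE v1.9 item 9 (deputy-2 06:55:57Z, F25 accepted): `govRuled = govByP` for all four readers,
  `ruled_coherent`, `zr_under_item9`; and «a fenced band is absent for EVERY check» (`check_through_fence_eq_noband`, the W8 split of the
  generative sweep closed: `w8_split_closed`).
-/

namespace Summit.Ventures.CertifiedManyBodySolver.Downfold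

namespace CellScore

/-! ## §1 The two flags of a column and the two readings -/

/-- What the scorer can see of a column's router primary: whether the material-level `words[0]` is an UND:* word, and — when
`header.router.by_P` lists this column's P — whether THAT row's primary is an UND:* word (`none` = no row for this P). [folklore] -/
structure ColPrim where
  /-- `header.router.words[0]` is an `UND:*` word -/
  hdrUND : Bool
  /-- the `by_P` row at this P: `some b` with `b` = its primary is `UND:*`; `none` = no such row -/
  rowUND : Option Bool
  deriving DecidableEq, Repr

/-- Reading H (material-level): the column is governed by `words[0]` whatever `by_P` says (score.py v1.8 l.455 `prim = rw[0]`
for W9; phasemap ≤ 1.8.7's staged fence). [folklore] -/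
def govHeader (c : ColPrim) : Bool := c.hdrUND

/-- Reading P (per column): the `by_P` row governs when present, else `words[0]` (deputy-2's v1.9 draft item 7, `undband_audit`,
phasemap 1.8.8 `router_primary_at`). [folklore] -/
def govByP (c : ColPrim) : Bool := c.rowUND.getD c.hdrUND

/-- A column is SPLIT when its by_P row exists and disagrees with words[0]. [folklore] -/
def split (c : ColPrim) : Bool := match c.rowUND with
  | none => false
  | some b => b != c.hdrUND

/-- No by_P row ⇒ the readings coincide. [folklore] -/
theorem govByP_of_none (h : Bool) : govByP ⟨h, none⟩ = govHeader ⟨h, none⟩ := rfl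

/-- A by_P row agreeing with words[0] ⇒ the readings coincide. [folklore] -/
theorem govByP_of_agree (h : Bool) : govByP ⟨h, some h⟩ = govHeader ⟨h, some h⟩ := by cases h <;> rfl

/-- The readings coincide exactly on the non-split columns. [folklore] -/
theorem govByP_eq_govHeader_iff_not_split (c : ColPrim) : govByP c = govHeader c ↔ split c = false := by
  obtain ⟨h, r⟩ := c
  cases r with
  | none => simp [govByP, govHeader, split]
  | some b => cases b <;> cases h <;> simp [govByP, govHeader, split]

/-- … and differ exactly on the split ones. [folklore] -/
theorem govByP_ne_govHeader_iff_split (c : ColPrim) : govByP c ≠ govHeader c ↔ split c = true := by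
  rw [Ne, govByP_eq_govHeader_iff_not_split]; simp

/-- The live column of record: M86 Zr @30 — words[0] «UND:MIXED» (UND), by_P @30 «EPH» (decided). [folklore] -/
def zrP30 : ColPrim := ⟨true, some false⟩

/-- Its @0 column: words[0] «UND:MIXED», by_P @0 «UND:MIXED». [folklore] -/
def zrP0 : ColPrim := ⟨true, some true⟩

/-- Zr @30 is split: UND by the material-level reading, decided by the per-P one. [folklore] -/
theorem zrP30_split : split zrP30 = true ∧ govHeader zrP30 = true ∧ govByP zrP30 = false := by decide

/-- Zr @0 is not split (both UND). [folklore] -/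
theorem zrP0_not_split : split zrP0 = false ∧ govHeader zrP0 = true ∧ govByP zrP0 = true := by decide

/-! ## §2 The item-7 fence per column and the F25 witness -/

/-- The item-7 fence per column under a reading `g`: a band on a column whose governing primary is UND is NOT read. [folklore] -/
def bandRead (g : ColPrim → Bool) (c : ColPrim) (band : Option (ℚ × ℚ)) : Option (ℚ × ℚ) :=
  if g c then none else band

/-- Under a governing UND primary the band is dropped. [folklore] -/
theorem bandRead_of_gov {g : ColPrim → Bool} {c : ColPrim} (h : g c = true) (band : Option (ℚ × ℚ)) :
    bandRead g c band = none := by simp [bandRead, h]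

/-- Under a governing decided primary the band is read as issued. [folklore] -/
theorem bandRead_of_not_gov {g : ColPrim → Bool} {c : ColPrim} (h : g c = false) (band : Option (ℚ × ℚ)) :
    bandRead g c band = band := by simp [bandRead, h]

/-- The §4.5 verdict of a two-column material under a reading: all cell words are read; each column's band passes the fence of
that column. (Two columns = the F25 shape: one at the lowest routed P carrying words[0], one at a higher P with its own row.) [folklore] -/
def verdict2 (g : ColPrim → Bool) (Tfloor : ℚ) (cA cB : ColPrim) (cellsA cellsB : List (ℚ × Word))
    (bandA bandB : Option (ℚ × ℚ)) : Verdict :=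
  verdict Tfloor (cellsA ++ cellsB) ((bandRead g cA bandA).toList ++ (bandRead g cB bandB).toList)

/-- Cells written under an UND primary on both columns are all `undetermined`. [folklore] -/
theorem cells2_UND_all (gA gB : List (ℚ × Stage)) :
    ∀ c ∈ cellsUnder .UND gA ++ cellsUnder .UND gB, c.2 = Word.undetermined := by
  intro c hc
  rcases List.mem_append.mp hc with h | h
  · exact cellsUnder_UND_all gA c h
  · exact cellsUnder_UND_all gB c h

/-- **F25 WITNESS, per-P reading.** The Zr shape — every cell `undetermined` (written under the UND material word), no band at @0,
an e–ph band [lo, hi] with lo ≥ 1/10 K on the @30 column whose by_P row is decided: the band is READ ⇒ §4.5 says SC. [folklore] -/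
theorem f25_witness_byP (Tfloor : ℚ) (gA gB : List (ℚ × Stage)) {lo hi : ℚ} (h : (1 : ℚ) / 10 ≤ lo) :
    verdict2 govByP Tfloor zrP0 zrP30 (cellsUnder .UND gA) (cellsUnder .UND gB) none (some (lo, hi)) = .SC := by
  have hA : bandRead govByP zrP0 none = none := by decide
  have hB : bandRead govByP zrP30 (some (lo, hi)) = some (lo, hi) := bandRead_of_not_gov (by decide) _
  simp only [verdict2, hA, hB, Option.toList_none, Option.toList_some, List.nil_append]
  exact verdict_cons_band h

/-- **F25 WITNESS, material-level reading.** The same map: both columns governed by words[0] = UND ⇒ both bands fenced ⇒ the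
verdict reads cell words only ⇒ UNDETERMINED. [folklore] -/
theorem f25_witness_header (Tfloor : ℚ) (gA gB : List (ℚ × Stage)) (bandB : Option (ℚ × ℚ)) :
    verdict2 govHeader Tfloor zrP0 zrP30 (cellsUnder .UND gA) (cellsUnder .UND gB) none bandB = .UNDETERMINED := by
  have hA : bandRead govHeader zrP0 none = none := by decide
  have hB : bandRead govHeader zrP30 bandB = none := bandRead_of_gov (by decide) _
  simp only [verdict2, hA, hB, Option.toList_none, List.nil_append]
  exact verdict_of_all_undetermined (cells2_UND_all gA gB)

/-- **The two readings decide the same map differently**: TP (known superconductor — Zr @30 GPa, T_c = 11 K) or FP by the per-P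
reading, ABSTAIN by the material-level one. A scored number of record moves with the choice the moment such a band lands. [folklore] -/
theorem f25_kinds (Tfloor : ℚ) (gA gB : List (ℚ × Stage)) {lo hi : ℚ} (h : (1 : ℚ) / 10 ≤ lo) (isSC : Bool) :
    kind (verdict2 govByP Tfloor zrP0 zrP30 (cellsUnder .UND gA) (cellsUnder .UND gB) none (some (lo, hi))) isSC
      = (if isSC then .TP else .FP) ∧
    kind (verdict2 govHeader Tfloor zrP0 zrP30 (cellsUnder .UND gA) (cellsUnder .UND gB) none (some (lo, hi))) isSC
      = .ABSTAIN := by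
  rw [f25_witness_byP Tfloor gA gB h, f25_witness_header]
  cases isSC <;> exact ⟨rfl, rfl⟩

/-- The CONVERSE shape (vector i7-byp-header-eph-rows-und): words[0] decided («EPH») but both by_P rows UND, a band on each column:
per-P ⇒ both fenced ⇒ UNDETERMINED; material-level ⇒ both read ⇒ SC. [folklore] -/
theorem f25_converse (Tfloor : ℚ) (gA gB : List (ℚ × Stage)) {lo hi : ℚ} (h : (1 : ℚ) / 10 ≤ lo) (bandB : Option (ℚ × ℚ)) :
    verdict2 govByP Tfloor ⟨false, some true⟩ ⟨false, some true⟩ (cellsUnder .UND gA) (cellsUnder .UND gB)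
        (some (lo, hi)) bandB = .UNDETERMINED ∧
    verdict2 govHeader Tfloor ⟨false, some true⟩ ⟨false, some true⟩ (cellsUnder .UND gA) (cellsUnder .UND gB)
        (some (lo, hi)) bandB = .SC := by
  constructor
  · have hA : bandRead govByP ⟨false, some true⟩ (some (lo, hi)) = none := bandRead_of_gov (by decide) _
    have hB : bandRead govByP ⟨false, some true⟩ bandB = none := bandRead_of_gov (by decide) _
    simp only [verdict2, hA, hB, Option.toList_none, List.nil_append]
    exact verdict_of_all_undetermined (cells2_UND_all gA gB)
  · have hA : bandRead govHeader ⟨false, some true⟩ (some (lo, hi)) = some (lo, hi) := bandRead_of_not_gov (by decide) _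
    simp only [verdict2, hA, Option.toList_some, List.singleton_append]
    exact verdict_cons_band h

/-- The material-level reading with both columns sharing words[0] is exactly `PhaseMapBranchRoads.verdictFenced` with that one flag
(the shape phasemap ≤ 1.8.7 staged): one Boolean for the whole map. [folklore] -/
theorem verdict2_header_eq_verdictFenced (Tfloor : ℚ) (hdr : Bool) (rA rB : Option Bool) (cellsA cellsB : List (ℚ × Word))
    (bandA bandB : Option (ℚ × ℚ)) :
    verdict2 govHeader Tfloor ⟨hdr, rA⟩ ⟨hdr, rB⟩ cellsA cellsB bandA bandB
      = verdictFenced hdr Tfloor (cellsA ++ cellsB) (bandA.toList ++ bandB.toList) := by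
  cases hdr <;> simp [verdict2, verdictFenced, bandRead, govHeader]

/-! ## §3 W9 and the fence must share one reading -/

/-- ACCEPTANCE §3.3 R-2W (c) as a per-cell predicate: W9 fires on a «not» cell whose governing primary is UND (the «undetermined →
not» upgrade from a secondary channel). `primUND` = whichever reading the engine applies. [folklore] -/
def w9 (primUND : Bool) (w : Word) : Bool := primUND && decide (w = Word.not)

/-- W9 never fires under a decided governing primary. [folklore] -/
theorem w9_decided (w : Word) : w9 false w = false := by simp [w9]

/-- W9 fires on every «not» cell under an UND governing primary. [folklore] -/
theorem w9_UND_not : w9 true Word.not = true := by decide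

/-- W9 never fires on `undetermined` or «SC» cells. [folklore] -/
theorem w9_of_ne_not {w : Word} (h : w ≠ Word.not) (p : Bool) : w9 p w = false := by
  cases p <;> cases w <;> simp_all [w9]

/-- **COHERENCE under ONE reading.** If W9 and the fence read the same governing flag `g c`, then on any column either the band
is read and no cell draws W9 (decided primary), or the band is fenced and the «not» cells draw W9 (UND primary) — never both. [folklore] -/
theorem coherent_of_one_reading (g : ColPrim → Bool) (c : ColPrim) (band : ℚ × ℚ) (w : Word) :
    ¬ (bandRead g c (some band) = some band ∧ w9 (g c) w = true) := by
  rintro ⟨hread, hw⟩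
  cases hg : g c
  · simp [w9, hg] at hw
  · simp [bandRead, hg] at hread

/-- Equivalently: a read band certifies that W9 is silent on that column. [folklore] -/
theorem w9_false_of_bandRead (g : ColPrim → Bool) (c : ColPrim) (band : ℚ × ℚ) (w : Word)
    (h : bandRead g c (some band) = some band) : w9 (g c) w = false := by
  cases hg : g c
  · exact w9_decided w ▸ (by simp [w9])
  · simp [bandRead, hg] at h

/-- **INCOHERENCE of the MIXED pair** (W9 by words[0] — score.py v1.8 / the v1.9 draft / phasemap; fence by by_P — the draft's
item 7 / phasemap 1.8.8): on the Zr @30 column an e–ph band is READ (the column is treated as decided) AND every «not» cell above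
the band draws W9 «under primary UND:MIXED» (the column is treated as UND) — from the same map. [folklore] -/
theorem mixed_readers_incoherent (band : ℚ × ℚ) :
    bandRead govByP zrP30 (some band) = some band ∧ w9 (govHeader zrP30) Word.not = true := by
  refine ⟨bandRead_of_not_gov (by decide) _, by decide⟩

/-- The other mixed pair (W9 by by_P, fence by words[0]) is incoherent on the converse column (words[0] decided, row UND): the
band would be read while W9 fires. Either uniform choice removes both. [folklore] -/
theorem mixed_readers_incoherent' (band : ℚ × ℚ) :
    bandRead govHeader ⟨false, some true⟩ (some band) = some band ∧ w9 (govByP ⟨false, some true⟩) Word.not = true := by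
  refine ⟨bandRead_of_not_gov (by decide) _, by decide⟩

/-- The F22 DECIDABILITY premise per material: «every column's governing primary is UND» (then every cell is `router:UND` by
construction and, with the fence, no band decides — the material cannot leave ABSTAIN under the words of record). [folklore] -/
def blocked (g : ColPrim → Bool) (cols : List ColPrim) : Bool := cols.all g

/-- Zr = [@0, @30] is blocked by the material-level reading and NOT blocked by the per-P one — tools/distance_to_pass.py and
words_preview.py («by_P-aware ceilings», g6/g7) already count per-P: M86 is absent from the v3 conventional blocked list (25/29). [folklore] -/
theorem blocked_split : blocked govHeader [zrP0, zrP30] = true ∧ blocked govByP [zrP0, zrP30] = false := by decide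

/-- Under ANY reading, a blocked material all of whose cells are `undetermined` abstains whatever bands ride on its two columns
(the per-column generalisation of `verdictFenced_UND`). [folklore] -/
theorem verdict2_blocked (g : ColPrim → Bool) (Tfloor : ℚ) (cA cB : ColPrim) (hb : blocked g [cA, cB] = true)
    (gA gB : List (ℚ × Stage)) (bandA bandB : Option (ℚ × ℚ)) :
    verdict2 g Tfloor cA cB (cellsUnder .UND gA) (cellsUnder .UND gB) bandA bandB = .UNDETERMINED := by
  simp only [blocked, List.all_cons, List.all_nil, Bool.and_true, Bool.and_eq_true] at hb
  have hA : bandRead g cA bandA = none := bandRead_of_gov hb.1 _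
  have hB : bandRead g cB bandB = none := bandRead_of_gov hb.2 _
  simp only [verdict2, hA, hB, Option.toList_none, List.nil_append]
  exact verdict_of_all_undetermined (cells2_UND_all gA gB)

/-- … so its confusion entry is ABSTAIN for either truth class (no floor member, no FP). [folklore] -/
theorem kind_verdict2_blocked (g : ColPrim → Bool) (Tfloor : ℚ) (cA cB : ColPrim) (hb : blocked g [cA, cB] = true)
    (gA gB : List (ℚ × Stage)) (bandA bandB : Option (ℚ × ℚ)) (isSC : Bool) :
    kind (verdict2 g Tfloor cA cB (cellsUnder .UND gA) (cellsUnder .UND gB) bandA bandB) isSC = .ABSTAIN := by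
  rw [verdict2_blocked g Tfloor cA cB hb]; cases isSC <;> rfl

/-! ## §4 The agreement case: every run of record so far -/

/-- On a non-split column every quantity built from the governing flag coincides under the two readings: the fence … [folklore] -/
theorem bandRead_coincide (c : ColPrim) (h : split c = false) (band : Option (ℚ × ℚ)) :
    bandRead govByP c band = bandRead govHeader c band := by
  rw [bandRead, bandRead, (govByP_eq_govHeader_iff_not_split c).mpr h]

/-- … the W9 predicate … [folklore] -/
theorem w9_coincide (c : ColPrim) (h : split c = false) (w : Word) : w9 (govByP c) w = w9 (govHeader c) w := by
  rw [(govByP_eq_govHeader_iff_not_split c).mpr h]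

/-- … the two-column verdict … [folklore] -/
theorem verdict2_coincide (Tfloor : ℚ) (cA cB : ColPrim) (hA : split cA = false) (hB : split cB = false)
    (cellsA cellsB : List (ℚ × Word)) (bandA bandB : Option (ℚ × ℚ)) :
    verdict2 govByP Tfloor cA cB cellsA cellsB bandA bandB = verdict2 govHeader Tfloor cA cB cellsA cellsB bandA bandB := by
  simp only [verdict2, bandRead_coincide cA hA, bandRead_coincide cB hB]

/-- … and the decidability premise, for any list of non-split columns. [folklore] -/
theorem blocked_coincide (cols : List ColPrim) (h : ∀ c ∈ cols, split c = false) :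
    blocked govByP cols = blocked govHeader cols := by
  induction cols with
  | nil => rfl
  | cons c tl ih =>
    have hc := (govByP_eq_govHeader_iff_not_split c).mpr (h c (by simp))
    have htl := ih (fun d hd => h d (by simp [hd]))
    simp only [blocked, List.all_cons] at htl ⊢
    rw [hc, htl]

/-- THE AGREEMENT CASE in one statement: if no column of the material is split (no by_P rows, or rows that repeat words[0] —
92 of the 96 by_P-carrying maps of RUN #18, and all 178 non-split materials), the per-P and material-level readings give the same
fence on every column, the same W9 on every cell and the same decidability premise — which is why both engines and the pen's
audit agree at diff 0 on every run of record while disagreeing on the rule (F25 is invisible until a split column carries a band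
or a «not» cell). [folklore] -/
theorem all_coincide_of_no_split (Tfloor : ℚ) (cA cB : ColPrim) (hA : split cA = false) (hB : split cB = false) :
    (∀ band, bandRead govByP cA band = bandRead govHeader cA band) ∧
    (∀ band, bandRead govByP cB band = bandRead govHeader cB band) ∧
    (∀ w, w9 (govByP cA) w = w9 (govHeader cA) w) ∧ (∀ w, w9 (govByP cB) w = w9 (govHeader cB) w) ∧
    (∀ cellsA cellsB bandA bandB, verdict2 govByP Tfloor cA cB cellsA cellsB bandA bandB
        = verdict2 govHeader Tfloor cA cB cellsA cellsB bandA bandB) ∧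
    blocked govByP [cA, cB] = blocked govHeader [cA, cB] :=
  ⟨bandRead_coincide cA hA, bandRead_coincide cB hB, w9_coincide cA hA, w9_coincide cB hB,
   fun cellsA cellsB bandA bandB => verdict2_coincide Tfloor cA cB hA hB cellsA cellsB bandA bandB,
   blocked_coincide [cA, cB] (by intro c hc; simp at hc; rcases hc with rfl | rfl <;> assumption)⟩

/-- Numbers of record (RUN #18 = maps/run-2026-08-27m, 182 maps): 96 maps carry `by_P`; 6 columns on 4 materials are split;
182 − 4 = 178 materials have no split column. [folklore] -/
theorem run18_split_census : (96 : ℕ) ≤ 182 ∧ 182 - 4 = 178 ∧ (6 : ℕ) = 1 + 1 + 2 + 2 := by decide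

/-! ## §5 The ruling (ACCEPTANCE v1.9 item 9, deputy-2 2026-08-27T06:55:57Z — F25 ACCEPTED): ONE governing primary per column for all four
readers; and «a fenced band is absent for every check» (phasemap 1.8.10 after kit sweep fuzz21 j271842) -/

/-- Item 9 as ruled: the governing reading is the per-P one, for W9, H2:C6-UND, the (e) road and the item-7 fence alike («R44 honest-abstention
and §4.5b honest-flag stay MATERIAL-level» — class-floor bookkeeping, outside this file). [folklore] -/
def govRuled : ColPrim → Bool := govByP

/-- Under the ruling every column is COHERENT: W9 and the fence read the same flag, so a read band never meets a W9 on the same column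
(`coherent_of_one_reading` instantiated) — the incoherence of §3's mixed pair cannot occur after v1.9. [folklore] -/
theorem ruled_coherent (c : ColPrim) (band : ℚ × ℚ) (w : Word) :
    ¬ (bandRead govRuled c (some band) = some band ∧ w9 (govRuled c) w = true) :=
  coherent_of_one_reading govByP c band w

/-- The Zr material under the ruling, column by column: @30 (row «EPH») — band READ, no W9 on its «not» cells; @0 (row «UND:MIXED») — band
fenced, W9 on any «not» cell. (Pre-freeze the v1.8 letter reads words[0] at @30 too: W9 there, band read — named by the pen if it happens.) [folklore] -/
theorem zr_under_item9 (b : ℚ × ℚ) :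
    bandRead govRuled zrP30 (some b) = some b ∧ w9 (govRuled zrP30) Word.not = false ∧
    bandRead govRuled zrP0 (some b) = none ∧ w9 (govRuled zrP0) Word.not = true := by
  refine ⟨bandRead_of_not_gov (by decide) _, by decide, bandRead_of_gov (by decide) _, by decide⟩

/-- Every check that reads a column's band — §4.5 verdict, §4.4 inside-band, W3 band-vs-word, W3b own-certificate, W8 band-vs-registry — reads it
THROUGH the fence: as a function of the band it factors through `bandRead`. (phasemap ≤ 1.8.9 fed the raw band to W8; the generative sweep found
25 REJECT-vs-ACCEPT splits against the pen's draft on exactly that; 1.8.10 routes W8 through the fence too.) A check so routed cannot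
distinguish a fenced band from no band at all: [folklore] -/
theorem check_through_fence_eq_noband {β : Type} (chk : Option (ℚ × ℚ) → β) {g : ColPrim → Bool} {c : ColPrim} (h : g c = true)
    (band : Option (ℚ × ℚ)) : chk (bandRead g c band) = chk none := by
  rw [bandRead_of_gov h]

/-- … while on an un-fenced column it sees the band as issued. [folklore] -/
theorem check_through_fence_eq_band {β : Type} (chk : Option (ℚ × ℚ) → β) {g : ColPrim → Bool} {c : ColPrim} (h : g c = false)
    (band : Option (ℚ × ℚ)) : chk (bandRead g c band) = chk band := by
  rw [bandRead_of_not_gov h]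

/-- The W8 shape of the sweep as a Boolean check «band lo above a registered certified T_c upper bound U» (REJECT when true): routed through
the fence it is `false` on every fenced column whatever the band says — the pen's ACCEPT — and the raw reading can be `true` — phasemap
1.8.9's REJECT. Witness: U = 337/10 K, band [4322/100, 1119/10] K on an UND-governed column (seed 6012, M28). [folklore] -/
def w8BandAboveUpper (U : ℚ) : Option (ℚ × ℚ) → Bool
  | none => false
  | some (lo, _) => decide (U < lo)

/-- The split of record, closed: fenced reading `false` (ACCEPT), raw reading `true` (REJECT). [folklore] -/
theorem w8_split_closed :
    w8BandAboveUpper (337 / 10) (bandRead govRuled zrP0 (some (4322 / 100, 1119 / 10))) = false ∧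
    w8BandAboveUpper (337 / 10) (some (4322 / 100, 1119 / 10)) = true := by
  refine ⟨?_, by simp only [w8BandAboveUpper, decide_eq_true_eq]; norm_num⟩
  rw [check_through_fence_eq_noband (w8BandAboveUpper (337 / 10)) (show govRuled zrP0 = true by decide)]
  rfl

end CellScore

end Summit.Ventures.CertifiedManyBodySolver.Downfold
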